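import Literature.NumberTheory.EllipticCurves.RingClassFieldGenusDiscriminantProofs
import Literature.NumberTheory.QuadraticFields.SquareRootGenerator
import Mathlib.FieldTheory.IsAlgClosed.Basic
import HarnessLib

/-!
# Genus theory at the DYADIC prime discriminant: `√T ∈ K[1]` whenever `d_K = T·m` with `m ≡ 1 (mod 4)` square-free
# (door D «`ℓ₀ = 2` as the twisted Wan prime» of crux 19357 `GordTwoRankZeroOffCaseOne`, line `three_field_road`, LeadReport27 §5 item 5;
# LEAD cruxlead-19357 g18, `--supports` 19357, groundwork helper only)

Theorems only (no definition, no named fact, no `sorry`). The E3′ kernel at an ODD twisted Wan prime `ℓ₀` uses `√ℓ₀* ∈ H_K = K[1]`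
(`sqrt_primeStar_mem_ringClassField_one`, Cox Thm. 6.1) to descend the `ν`-isotypic Heegner point (`ν = χ_{ℓ₀*} ∘ N`). At `ℓ₀ = 2` the prime
discriminant is `t* ∈ {−4, 8, −8}` and `d_K = t*·m` with `m ≡ 1 (mod 4)` an ODD fundamental discriminant (pen e21 §1). This file proves the dyadic
clause of Gauss's genus theory in the currency of the odd one, by MULTIPLICATIVITY rather than by a new residue computation: every odd prime `q ∣ m`
divides `d_K`, so `√q* ∈ K[1]`; `∏_{q ∣ m} q* = m` (both sides are `≡ 1 (mod 4)` with the same absolute value, `m` square-free); hence `√m ∈ K[1]`;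
and `√d_K ∈ K ⊆ K[1]` (`d_K` is the radicand of `K` up to a rational square), so `√T = ± √d_K / √m ∈ K[1]`. No parity hypothesis on `T` is needed.

* `prod_primeStar_primeFactors_eq` — `∏_{q ∣ |m|} q* = m` for `m ≡ 1 (mod 4)` square-free;
* `sqrt_intCast_mem_ringClassField_one_of_emod_four` — `√m ∈ K[1]` for such `m ∣ d_K`;
* `sqrt_discr_mem_ringClassField_one` — `√d_K ∈ K[1]`;
* **`sqrt_mem_ringClassField_one_of_discr_eq_mul`** — `√T ∈ K[1]` for `d_K = T·m`, `m ≡ 1 (mod 4)` square-free (door D: `T = t*`).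

References: [Cox2013] §6.A Thm. 6.1 (the genus field is `K(√p₁*, …, √p_r*)`); [NeukirchANT1999] VII (13.9). BSD is proved for no curve by any of this.
presearch: n/a (tree assembly: `sqrt_primeStar_mem_ringClassField_one` + `NumberField.exists_discr_eq_mul_sq`).
-/

set_option linter.dupNamespace false
set_option autoImplicit false

noncomputable section

open scoped Classical
open NumberField

namespace Summit.BirchSwinnertonDyer.BirchSwinnertonDyer.Theorems.TwistedWanRoad

open Literature.NumberTheory.EllipticCurves

variable {K : Type} [Field K] [NumberField K]

/-! ### §1 `∏_{q ∣ |m|} q* = m` -/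

/-- A product of integers `≡ 1 (mod 4)` is `≡ 1 (mod 4)`. [folklore] -/
private theorem prod_emod_four' {ι : Type*} (S : Finset ι) (f : ι → ℤ) (hf : ∀ i ∈ S, f i % 4 = 1) :
    (∏ i ∈ S, f i) % 4 = 1 := by
  induction S using Finset.induction_on with
  | empty => simp
  | insert a S ha ih =>
    rw [Finset.prod_insert ha, Int.mul_emod, hf a (Finset.mem_insert_self a S),
      ih (fun i hi ↦ hf i (Finset.mem_insert_of_mem hi))]
    norm_num

/-- **`∏_{q ∣ |m|} q* = m`** for a square-free integer `m ≡ 1 (mod 4)` (`q* = (−1)^{(q−1)/2} q` over the prime factors of `|m|`): the product has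
absolute value `|m|` (`m` square-free) and is `≡ 1 (mod 4)` like `m`, so the signs agree. [cite: Cox2013, §1.C Lemma 1.14] -/
theorem prod_primeStar_primeFactors_eq {m : ℤ} (hm4 : m % 4 = 1) (hmsq : Squarefree m) :
    (∏ q ∈ m.natAbs.primeFactors, ((-1 : ℤ) ^ (q / 2) * q)) = m := by
  have hm0 : m ≠ 0 := by rintro rfl; norm_num at hm4
  have hMsq : Squarefree m.natAbs := Int.squarefree_natAbs.mpr hmsq
  -- every prime factor of `|m|` is odd
  have hodd : ∀ q ∈ m.natAbs.primeFactors, q.Prime ∧ q ≠ 2 := by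
    intro q hq
    obtain ⟨hqp, hqd, -⟩ := Nat.mem_primeFactors.mp hq
    refine ⟨hqp, ?_⟩
    rintro rfl
    have h2 : (2 : ℤ) ∣ m := by
      have : ((2 : ℕ) : ℤ) ∣ (m.natAbs : ℤ) := Int.natCast_dvd_natCast.mpr hqd
      simpa using (Int.dvd_natAbs.mp this)
    omega
  -- the product splits as (sign) · |m|
  have hsplit : (∏ q ∈ m.natAbs.primeFactors, ((-1 : ℤ) ^ (q / 2) * q)) =
      (∏ q ∈ m.natAbs.primeFactors, (-1 : ℤ) ^ (q / 2)) * ((m.natAbs : ℕ) : ℤ) := by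
    rw [Finset.prod_mul_distrib]
    congr 1
    conv_rhs => rw [← Nat.prod_primeFactors_of_squarefree hMsq]
    push_cast
    rfl
  have hsign : (∏ q ∈ m.natAbs.primeFactors, (-1 : ℤ) ^ (q / 2)) = 1 ∨
      (∏ q ∈ m.natAbs.primeFactors, (-1 : ℤ) ^ (q / 2)) = -1 := by
    rw [Finset.prod_pow_eq_pow_sum]
    exact neg_one_pow_eq_or ℤ _
  have hP4 : (∏ q ∈ m.natAbs.primeFactors, ((-1 : ℤ) ^ (q / 2) * q)) % 4 = 1 :=
    prod_emod_four' _ _ fun q hq ↦ primeStar_emod_four (hodd q hq).1 (hodd q hq).2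
  have habs : m = (m.natAbs : ℤ) ∨ m = -(m.natAbs : ℤ) := Int.natAbs_eq m
  rw [hsplit] at hP4 ⊢
  rcases hsign with hs | hs <;> rw [hs] at hP4 ⊢ <;> rcases habs with h | h <;> omega

/-! ### §2 Square roots in the Hilbert class field -/

/-- **`√m ∈ K[1]` for `m ≡ 1 (mod 4)` square-free dividing `d_K`** (`K` imaginary quadratic): `√m = ∏_{q ∣ m} √q*` up to sign and each `√q*` lies in
`K[1]` (`sqrt_primeStar_mem_ringClassField_one`, Cox Thm. 6.1). [cite: Cox2013, §6.A Thm. 6.1] -/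
theorem sqrt_intCast_mem_ringClassField_one_of_emod_four (hK : IsImaginaryQuadratic K) (ι : K →+* ℂ) {m : ℤ}
    (hm4 : m % 4 = 1) (hmsq : Squarefree m) (hmD : m ∣ NumberField.discr K) (r : ℂ) (hr : r ^ 2 = (m : ℂ)) :
    r ∈ ringClassField K ι 1 := by
  -- a square root of each `q*`
  have hex : ∀ q : ℕ, ∃ z : ℂ, z ^ 2 = (((-1 : ℤ) ^ (q / 2) * q : ℤ) : ℂ) := fun q ↦
    IsAlgClosed.exists_pow_nat_eq _ two_pos
  choose f hf using hex
  have hmem : ∀ q ∈ m.natAbs.primeFactors, f q ∈ ringClassField K ι 1 := by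
    intro q hq
    obtain ⟨hqp, hqd, -⟩ := Nat.mem_primeFactors.mp hq
    have hq2 : q ≠ 2 := by
      rintro rfl
      have h2 : (2 : ℤ) ∣ m := by
        have : ((2 : ℕ) : ℤ) ∣ (m.natAbs : ℤ) := Int.natCast_dvd_natCast.mpr hqd
        simpa using (Int.dvd_natAbs.mp this)
      omega
    have hqm : (q : ℤ) ∣ m := Int.dvd_natAbs.mp (Int.natCast_dvd_natCast.mpr hqd)
    exact sqrt_primeStar_mem_ringClassField_one hK ι hqp hq2 (hqm.trans hmD) (f q) (hf q)
  set R : ℂ := ∏ q ∈ m.natAbs.primeFactors, f q with hRdef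
  have hRmem : R ∈ ringClassField K ι 1 := Subfield.prod_mem _ hmem
  have hR2 : R ^ 2 = (m : ℂ) := by
    rw [hRdef, ← Finset.prod_pow, Finset.prod_congr rfl (fun q _ ↦ hf q), ← Int.cast_prod,
      prod_primeStar_primeFactors_eq hm4 hmsq]
  rcases sq_eq_sq_iff_eq_or_eq_neg.mp (hr.trans hR2.symm) with h | h
  · rw [h]; exact hRmem
  · rw [h]; exact neg_mem hRmem

/-- **`√d_K ∈ K[1]`**: `d_K` is the radicand of the quadratic field `K` up to a rational square (`NumberField.exists_discr_eq_mul_sq`), so `√d_K ∈ K`,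
and `K ⊆ K[1]`. [folklore] -/
theorem sqrt_discr_mem_ringClassField_one (hK : IsImaginaryQuadratic K) (ι : K →+* ℂ) (r : ℂ)
    (hr : r ^ 2 = ((NumberField.discr K : ℤ) : ℂ)) : r ∈ ringClassField K ι 1 := by
  have h2 : Module.finrank ℚ K = 2 := hK.1
  obtain ⟨θ, c, hθ, hc⟩ := Literature.NumberTheory.QuadraticFields.Quadratic.exists_sq_eq_algebraMap (F := ℚ) (K := K) h2
  obtain ⟨q, hq0, hdq⟩ := NumberField.exists_discr_eq_mul_sq h2 hθ hc
  -- `k = θ·q` has `k² = d_K` in `K`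
  set k : K := θ * algebraMap ℚ K q with hk
  have hk2 : k ^ 2 = algebraMap ℚ K (NumberField.discr K : ℚ) := by
    rw [hk, mul_pow, hc, ← map_pow, ← map_mul, ← hdq]
  have hz2 : (ι k) ^ 2 = ((NumberField.discr K : ℤ) : ℂ) := by
    rw [← map_pow, hk2]
    simp
  rcases sq_eq_sq_iff_eq_or_eq_neg.mp (hr.trans hz2.symm) with h | h
  · rw [h]; exact apply_mem_ringClassField ι 1 k
  · rw [h]; exact neg_mem (apply_mem_ringClassField ι 1 k)

/-- **GENUS THEORY AT THE DYADIC PRIME DISCRIMINANT: `√T ∈ K[1]` for `d_K = T·m`, `m ≡ 1 (mod 4)` square-free** (`K` imaginary quadratic; door D: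
`T = t* ∈ {−4, 8, −8}`, `m` the odd part of `d_K`): `√T = ± √d_K / √m` with `√d_K ∈ K` and `√m ∈ K[1]` by the odd clause of genus theory applied
prime by prime. The `ℓ₀ = 2` companion of `sqrt_primeStar_mem_ringClassField_one`. [cite: Cox2013, §6.A Thm. 6.1] -/
theorem sqrt_mem_ringClassField_one_of_discr_eq_mul (hK : IsImaginaryQuadratic K) (ι : K →+* ℂ) {T m : ℤ}
    (hm4 : m % 4 = 1) (hmsq : Squarefree m) (hdK : NumberField.discr K = T * m)
    (r : ℂ) (hr : r ^ 2 = (T : ℂ)) : r ∈ ringClassField K ι 1 := by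
  have hm0 : m ≠ 0 := by rintro rfl; norm_num at hm4
  have hmC : (m : ℂ) ≠ 0 := by exact_mod_cast hm0
  -- `√m ∈ K[1]` and `√d_K ∈ K[1]`
  obtain ⟨R, hR⟩ := IsAlgClosed.exists_pow_nat_eq (m : ℂ) two_pos
  have hRmem := sqrt_intCast_mem_ringClassField_one_of_emod_four hK ι hm4 hmsq ⟨T, by rw [hdK, mul_comm]⟩ R hR
  obtain ⟨Z, hZ⟩ := IsAlgClosed.exists_pow_nat_eq ((NumberField.discr K : ℤ) : ℂ) two_pos
  have hZmem := sqrt_discr_mem_ringClassField_one hK ι Z hZ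
  have hR0 : R ≠ 0 := by
    rintro rfl
    rw [zero_pow two_ne_zero] at hR
    exact hmC hR.symm
  -- `(Z/R)² = d_K / m = T`
  have hZR : (Z / R) ^ 2 = (T : ℂ) := by
    rw [div_pow, hZ, hR, hdK, Int.cast_mul, mul_div_cancel_right₀ _ hmC]
  rcases sq_eq_sq_iff_eq_or_eq_neg.mp (hr.trans hZR.symm) with h | h
  · rw [h]; exact div_mem hZmem hRmem
  · rw [h]; exact neg_mem (div_mem hZmem hRmem)

end Summit.BirchSwinnertonDyer.BirchSwinnertonDyer.Theorems.TwistedWanRoad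

end
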